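import Mathlib.Algebra.Group.Subgroup.Even
import Mathlib.Algebra.QuadraticAlgebra.Basic
import Literature.NumberTheory.QuadraticForms.QuadraticNormIndexLocal
import HarnessLib

/-!
# The norm index of a quadratic extension counted through square classes

Topic `NumberTheory/QuadraticForms`; namespace `Literature`; all declarations fully proved. For a field
`F` with `2 ≠ 0`, a non-square `a ∈ F` and `E = F(√a)` (Mathlib `QuadraticAlgebra F a 0`, a
field), the norm group `N(Eˣ) = quadraticNormSubgroup F a ≤ Fˣ` (`QuadraticNormIndex.lean`)
satisfies the **counting identity**

  `(Fˣ : N(Eˣ)) · 2 · (Eˣ : Eˣ²) = (Fˣ : Fˣ²)²`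
  (`index_quadraticNormSubgroup_mul_two_mul_index_square`),

an identity of natural numbers (infinite indices count as `0`). Its inputs are elementary:

* `range_unitsMap_norm_eq_quadraticNormSubgroup` : `N(Eˣ) = quadraticNormSubgroup F a`
  (`N(p + qω) = p² - a q²`);
* `isSquare_or_of_isSquare_algebraMap` : `Fˣ ∩ Eˣ² = Fˣ² ∪ a Fˣ²`;
* `mem_sup_of_isSquare_norm` : **Hilbert's Theorem 90** for `E/F` in explicit form — a unit of
  norm `1` is `y²/N(y)` (`y = w + 1`), so the units whose norm is a square form `Fˣ · Eˣ²`;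

and the proof is the exact sequence `1 → Fˣ Eˣ²/Eˣ² → Eˣ/Eˣ² → Fˣ/Fˣ² → Fˣ/N(Eˣ) → 1`
(norm in the middle) together with `|Fˣ Eˣ²/Eˣ²| = |Fˣ/(Fˣ² ∪ aFˣ²)| = (Fˣ : Fˣ²)/2`, carried out
with Mathlib's index calculus (`Subgroup.index_ker`, `card_mul_index`, `relIndex_mul_index`,
`relIndex_eq_two_iff`).

Purpose: over a non-archimedean local field `F = K_v`, O'Meara 63:9 (`(Fˣ : Fˣ²) = 4q`,
`(Eˣ : Eˣ²) = 4q²` with `q = |𝒪_F/2𝒪_F|`; `SquareClassIndex.lean`) turns the identity into the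
**local norm index `(Fˣ : N(Eˣ)) = 2`** (O'Meara 63:13a) at every place, dyadic ones included,
without local class field theory — the remaining local input of the classification of quaternion
algebras over number fields (`Literature/NumberTheory/Automorphic/QuaternionAlgebraLocalUniqueness`).

## References

* O. T. O'Meara, *Introduction to quadratic forms*, Grundlehren 117, Springer (1963), §63B,
  63:13a; §65A (local norms).
* D. Hilbert, *Zahlbericht* (1897), Satz 90 (the cyclic case, here for a quadratic extension).
-/

noncomputable section

namespace Literature.NumberTheory.QuadraticForms

section Count

variable {F : Type*} [Field F] {a : F} [Fact (∀ r : F, r ^ 2 ≠ a + 0 * r)]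

local notation "E" => QuadraticAlgebra F a 0

omit [Fact (∀ r : F, r ^ 2 ≠ a + 0 * r)] in
/-- The norm `N(p + qω) = p² - a q²` of `E = F(√a) = QuadraticAlgebra F a 0`. [folklore] -/
theorem QuadraticAlgebra.norm_eq_sq_sub (z : E) : z.norm = z.re ^ 2 - a * z.im ^ 2 := by
  rw [QuadraticAlgebra.norm_def]; ring

/-- The norm group `N(Eˣ) ≤ Fˣ` of `E = F(√a)` is `quadraticNormSubgroup F a`. [folklore] -/
theorem range_unitsMap_norm_eq_quadraticNormSubgroup :
    (Units.map (QuadraticAlgebra.norm : E →* F)).range = quadraticNormSubgroup F a := by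
  ext t
  rw [mem_quadraticNormSubgroup_iff]
  constructor
  · rintro ⟨u, rfl⟩
    refine ⟨(u : E).re, (u : E).im, ?_⟩
    rw [Units.coe_map]
    exact (QuadraticAlgebra.norm_eq_sq_sub (u : E)).symm
  · rintro ⟨x, y, hxy⟩
    have hz : (⟨x, y⟩ : E) ≠ 0 := by
      intro h
      have hx : x = 0 := congrArg QuadraticAlgebra.re h
      have hy : y = 0 := congrArg QuadraticAlgebra.im h
      rw [hx, hy] at hxy
      exact t.ne_zero (by rw [← hxy]; ring)
    refine ⟨Units.mk0 _ hz, Units.ext ?_⟩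
    rw [Units.coe_map]
    change QuadraticAlgebra.norm (⟨x, y⟩ : E) = (t : F)
    rw [QuadraticAlgebra.norm_eq_sq_sub, ← hxy]

omit [Fact (∀ r : F, r ^ 2 ≠ a + 0 * r)] in
/-- An element of `F` which is a square in `E = F(√a)` is in `F²` or in `a F²`
(`(p + qω)² = p² + a q² + 2pq ω`, so `pq = 0`; `2 ≠ 0`). [folklore] -/
theorem isSquare_or_of_isSquare_algebraMap [NeZero (2 : F)] {t : F}
    (h : IsSquare (algebraMap F E t)) : IsSquare t ∨ IsSquare (a * t) := by
  obtain ⟨z, hz⟩ := h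
  have hre := congrArg QuadraticAlgebra.re hz
  have him := congrArg QuadraticAlgebra.im hz
  simp only [QuadraticAlgebra.algebraMap_re, QuadraticAlgebra.algebraMap_im,
    QuadraticAlgebra.re_mul, QuadraticAlgebra.im_mul, zero_mul, add_zero] at hre him
  -- `him : 0 = z.re * z.im + z.im * z.re`, `hre : t = z.re * z.re + a * z.im * z.im`
  have h2 : (2 : F) * (z.re * z.im) = 0 := by linear_combination -him
  rcases mul_eq_zero.mp h2 with h | h
  · exact absurd h two_ne_zero
  rcases mul_eq_zero.mp h with h | h
  · right; exact ⟨a * z.im, by rw [hre, h]; ring⟩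
  · left; exact ⟨z.re, by rw [hre, h]; ring⟩

/-- **Hilbert's Theorem 90 for `F(√a)/F`, explicit form**: a unit `w` of `E` of norm `1` is
`y²/N(y)` for some `y ∈ Eˣ` (`y = w + 1` if `w ≠ -1`, since `w σ(y) = N(w) + w = y`; and
`w = -1` is in `F`). Hence: the units of `E` whose norm is a square of `F` are exactly
`Fˣ · Eˣ²`. [folklore] -/
theorem mem_sup_of_isSquare_norm {u : Eˣ} {t : Fˣ}
    (h : QuadraticAlgebra.norm (u : E) = (t : F) ^ 2) :
    u ∈ (Units.map (algebraMap F E : F →* E)).range ⊔ Subgroup.square Eˣ := by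
  -- `w = u / t` has norm `1`
  set tE : Eˣ := Units.map (algebraMap F E : F →* E) t with htE
  set w : Eˣ := u * tE⁻¹ with hw
  have hNw : QuadraticAlgebra.norm (w : E) = 1 := by
    have hNt : QuadraticAlgebra.norm ((tE : Eˣ) : E) = (t : F) ^ 2 := by
      rw [htE, Units.coe_map, MonoidHom.coe_coe, QuadraticAlgebra.norm_eq_sq_sub]
      simp [QuadraticAlgebra.algebraMap_re, QuadraticAlgebra.algebraMap_im]
    have : QuadraticAlgebra.norm ((w * tE : Eˣ) : E) = QuadraticAlgebra.norm (w : E) * (t : F) ^ 2 := by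
      rw [Units.val_mul, map_mul, hNt]
    rw [hw, inv_mul_cancel_right, h] at this
    have ht0 : ((t : F) ^ 2) ≠ 0 := pow_ne_zero 2 t.ne_zero
    exact (mul_eq_right₀ ht0).mp this.symm
  have hu : u = w * tE := by rw [hw, inv_mul_cancel_right]
  rw [hu]
  refine Subgroup.mul_mem _ ?_ (Subgroup.mem_sup_left ⟨t, rfl⟩)
  -- Hilbert 90 for `w`
  have hwstar : (w : E) * star (w : E) = 1 := by
    rw [← QuadraticAlgebra.algebraMap_norm_eq_mul_star, hNw, map_one]
  by_cases hw1 : (w : E) = -1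
  · refine Subgroup.mem_sup_left ⟨-1, Units.ext ?_⟩
    rw [Units.coe_map, MonoidHom.coe_coe, Units.val_neg, Units.val_one, map_neg, map_one, hw1]
  · -- `y = w + 1 ≠ 0`, `w * star y = y`, so `w * N(y) = y²`
    have hy0 : (w : E) + 1 ≠ 0 := fun h0 ↦ hw1 (eq_neg_of_add_eq_zero_left h0)
    set y : E := (w : E) + 1 with hy
    have hwy : (w : E) * star y = y := by
      rw [hy, star_add, star_one, mul_add, hwstar, mul_one, add_comm]
    have hNy0 : QuadraticAlgebra.norm y ≠ 0 := by
      intro h0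
      have : y * star y = 0 := by rw [← QuadraticAlgebra.algebraMap_norm_eq_mul_star, h0, map_zero]
      rcases mul_eq_zero.mp this with h' | h'
      · exact hy0 h'
      · exact hy0 (by simpa using congrArg star h')
    -- `w = y² · N(y)⁻¹`
    have key : (w : E) = y ^ 2 * (algebraMap F E (QuadraticAlgebra.norm y))⁻¹ := by
      have hNyE : algebraMap F E (QuadraticAlgebra.norm y) ≠ 0 := by
        rwa [Ne, map_eq_zero_iff _ (algebraMap F E).injective]
      rw [eq_mul_inv_iff_mul_eq₀ hNyE, QuadraticAlgebra.algebraMap_norm_eq_mul_star, ← mul_assoc,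
        mul_comm (w : E) y, mul_assoc, hwy, sq]
    have hyu : IsUnit y := isUnit_iff_ne_zero.mpr hy0
    have hNu : IsUnit (QuadraticAlgebra.norm y) := isUnit_iff_ne_zero.mpr hNy0
    have h1 : hyu.unit ^ 2 ∈ Subgroup.square Eˣ := Subgroup.mem_square.mpr ⟨hyu.unit, by rw [sq]⟩
    have h2 : (Units.map (algebraMap F E : F →* E) hNu.unit)⁻¹ ∈
        (Units.map (algebraMap F E : F →* E)).range := Subgroup.inv_mem _ ⟨hNu.unit, rfl⟩
    have hw' : w = hyu.unit ^ 2 * (Units.map (algebraMap F E : F →* E) hNu.unit)⁻¹ := by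
      apply Units.ext
      rw [key, Units.val_mul, Units.val_pow_eq_pow_val, IsUnit.unit_spec, Units.val_inv_eq_inv_val,
        Units.coe_map]
      change _ = _ * ((algebraMap F E) (hNu.unit : F))⁻¹
      rw [IsUnit.unit_spec]
    rw [hw', sup_comm]
    exact Subgroup.mul_mem_sup h1 h2

/-- **The norm index counted through square classes.** For `E = F(√a)` (`a ∉ F²`, `2 ≠ 0`),
with `m = (Fˣ : Fˣ²)`: `(Fˣ : N(Eˣ)) · 2 · (Eˣ : Eˣ²) = m²`. Proof: `N̄ : Eˣ/Eˣ² → Fˣ/Fˣ²` has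
image `N(Eˣ)/Fˣ²` and kernel `Fˣ Eˣ²/Eˣ²` (Hilbert 90, `mem_sup_of_isSquare_norm`), and
`Fˣ Eˣ²/Eˣ² ≅ Fˣ/(Fˣ ∩ Eˣ²) = Fˣ/(Fˣ² ∪ aFˣ²)` (`isSquare_or_of_isSquare_algebraMap`) has
order `m/2`; so `(N(Eˣ) : Fˣ²) = (Eˣ : Eˣ²)/(m/2)` and `(Fˣ : N(Eˣ)) = m (m/2)/(Eˣ : Eˣ²)`.
(All indices may be infinite, i.e. `0`, the identity being one of natural numbers obtained from
`Subgroup.index_ker`, `Subgroup.card_mul_index`, `Subgroup.relIndex_mul_index` without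
division.) Over a local field, `m = 4q`, `(Eˣ : Eˣ²) = 4q²` (O'Meara 63:9) give the local norm
index `2` (63:13a). [folklore] -/
theorem index_quadraticNormSubgroup_mul_two_mul_index_square [NeZero (2 : F)] (ha : ¬ IsSquare a) :
    (quadraticNormSubgroup F a).index * (2 * (Subgroup.square Eˣ).index) =
      (Subgroup.square Fˣ).index ^ 2 := by
  set SF : Subgroup Fˣ := Subgroup.square Fˣ with hSF
  set SE : Subgroup Eˣ := Subgroup.square Eˣ with hSE
  set ιF : Fˣ →* Eˣ := Units.map (algebraMap F E : F →* E) with hιF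
  set Nh : Eˣ →* Fˣ := Units.map (QuadraticAlgebra.norm : E →* F) with hNh
  have hιF_inj : Function.Injective ιF := fun s t h ↦ by
    apply Units.ext
    have h' := congrArg (fun u : Eˣ ↦ (u : E)) h
    simp only [hιF, Units.coe_map, MonoidHom.coe_coe] at h'
    exact (algebraMap F E).injective h'
  have hN : Nh.range = quadraticNormSubgroup F a := range_unitsMap_norm_eq_quadraticNormSubgroup
  have hNιF : ∀ t : Fˣ, Nh (ιF t) = t * t := fun t ↦ by
    apply Units.ext
    rw [Units.coe_map, Units.val_mul]
    change QuadraticAlgebra.norm ((ιF t : Eˣ) : E) = _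
    rw [hιF, Units.coe_map, MonoidHom.coe_coe, QuadraticAlgebra.norm_eq_sq_sub,
      QuadraticAlgebra.algebraMap_re, QuadraticAlgebra.algebraMap_im]
    ring
  -- `Fˣ² ≤ N(Eˣ)`
  have hSF_le_N : SF ≤ Nh.range := by
    intro t ht
    obtain ⟨s, rfl⟩ := Subgroup.mem_square.mp ht
    exact ⟨ιF s, hNιF s⟩
  -- `ψ : Eˣ → Fˣ/Fˣ²`
  set ψ : Eˣ →* Fˣ ⧸ SF := (QuotientGroup.mk' SF).comp Nh with hψ
  -- (E3) `m = (Eˣ : ker ψ) · (Fˣ : N)`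
  have hE3 : SF.index = ψ.ker.index * (Nh.range).index := by
    rw [Subgroup.index_ker ψ, hψ, ← MonoidHom.map_range,
      ← Subgroup.index_map_eq (H := Nh.range) (QuotientGroup.mk'_surjective SF)
        (by rw [QuotientGroup.ker_mk']; exact hSF_le_N),
      Subgroup.card_mul_index, Subgroup.index_eq_card]
  -- (i) `ker ψ = Fˣ Eˣ²`
  have hker : ψ.ker = ιF.range ⊔ SE := by
    apply le_antisymm
    · intro u hu
      rw [MonoidHom.mem_ker, hψ, MonoidHom.comp_apply, QuotientGroup.mk'_apply,
        QuotientGroup.eq_one_iff] at hu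
      obtain ⟨t, ht⟩ := Subgroup.mem_square.mp hu
      refine mem_sup_of_isSquare_norm (t := t) ?_
      have := congrArg (fun x : Fˣ ↦ (x : F)) ht
      simpa [hNh, Units.coe_map, sq] using this
    · rw [sup_le_iff]
      constructor
      · rintro _ ⟨t, rfl⟩
        rw [MonoidHom.mem_ker, hψ, MonoidHom.comp_apply, QuotientGroup.mk'_apply,
          QuotientGroup.eq_one_iff, hNιF]
        exact Subgroup.mem_square.mpr ⟨t, rfl⟩
      · intro u hu
        obtain ⟨y, rfl⟩ := Subgroup.mem_square.mp hu
        rw [MonoidHom.mem_ker, hψ, MonoidHom.comp_apply, QuotientGroup.mk'_apply,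
          QuotientGroup.eq_one_iff, map_mul]
        exact Subgroup.mem_square.mpr ⟨Nh y, rfl⟩
  -- (E1) `T = {t ∈ Fˣ : t ∈ Eˣ²} ⊇ Fˣ²` with `(T : Fˣ²) = 2`
  set T : Subgroup Fˣ := SE.comap ιF with hT
  have hSF_le_T : SF ≤ T := by
    intro t ht
    obtain ⟨s, rfl⟩ := Subgroup.mem_square.mp ht
    rw [hT, Subgroup.mem_comap, map_mul]
    exact Subgroup.mem_square.mpr ⟨ιF s, rfl⟩
  have ha0 : a ≠ 0 := fun h ↦ ha ⟨0, by rw [h, mul_zero]⟩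
  set au : Fˣ := Units.mk0 a ha0 with hau
  have hmemT : ∀ t : Fˣ, t ∈ T ↔ IsSquare (t : F) ∨ IsSquare (a * t) := by
    intro t
    rw [hT, Subgroup.mem_comap, hSE, Subgroup.mem_square, isSquare_units_iff]
    constructor
    · intro h
      exact isSquare_or_of_isSquare_algebraMap (a := a) (by simpa [hιF] using h)
    · rintro (⟨s, hs⟩ | ⟨s, hs⟩)
      · refine ⟨algebraMap F E s, ?_⟩
        rw [hιF, Units.coe_map, MonoidHom.coe_coe, hs, map_mul]
      · -- `a t = s²` : `t = (s ω / a)²` with `ω² = a`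
        refine ⟨(algebraMap F E (s / a)) * QuadraticAlgebra.omega, ?_⟩
        have hω : (QuadraticAlgebra.omega : E) * QuadraticAlgebra.omega = algebraMap F E a := by
          ext <;> simp [QuadraticAlgebra.algebraMap_eq]
        rw [hιF, Units.coe_map, MonoidHom.coe_coe]
        calc algebraMap F E (t : F) = algebraMap F E ((s / a) * (s / a) * a) := by
              congr 1; field_simp; linear_combination hs
          _ = _ := by rw [map_mul, ← hω, map_mul]; ring
  have hmemSF : ∀ t : Fˣ, t ∈ SF ↔ IsSquare (t : F) := fun t ↦ by
    rw [hSF, Subgroup.mem_square, isSquare_units_iff]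
  have hE1 : SF.index = 2 * T.index := by
    have h2 : SF.relIndex T = 2 := by
      rw [Subgroup.relIndex_eq_two_iff]
      refine ⟨au, (hmemT au).mpr (Or.inr ⟨a, by rw [hau, Units.val_mk0]⟩), fun b hb ↦ ?_⟩
      rcases (hmemT b).mp hb with hsq | hsq
      · -- `b ∈ Fˣ²`, `b a ∉ Fˣ²`
        refine Or.inr ⟨(hmemSF b).mpr hsq, fun hba ↦ ha ?_⟩
        have hba' : IsSquare ((b : F) * a) := by simpa [hau] using (hmemSF _).mp hba
        obtain ⟨r, hr⟩ := hsq
        obtain ⟨q, hq⟩ := hba'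
        have hr0 : r ≠ 0 := fun h0 ↦ b.ne_zero (by rw [hr, h0, mul_zero])
        exact ⟨q / r, by field_simp; linear_combination hq - a * hr⟩
      · refine Or.inl ⟨(hmemSF _).mpr (by simpa [hau, mul_comm] using hsq), fun hbS ↦ ha ?_⟩
        obtain ⟨r, hr⟩ := (hmemSF b).mp hbS
        obtain ⟨q, hq⟩ := hsq
        have hr0 : r ≠ 0 := fun h0 ↦ b.ne_zero (by rw [hr, h0, mul_zero])
        exact ⟨q / r, by field_simp; linear_combination hq - a * hr⟩
    rw [← Subgroup.relIndex_mul_index hSF_le_T, h2]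
  -- (E2) `(Eˣ : Eˣ²) = (Fˣ : T) (Eˣ : Fˣ Eˣ²)`
  have hE2 : SE.index = T.index * (ιF.range ⊔ SE).index := by
    rw [← Subgroup.relIndex_mul_index (le_sup_right : SE ≤ ιF.range ⊔ SE),
      Subgroup.relIndex_sup_right, hT, MonoidHom.range_eq_map, ← Subgroup.relIndex_comap,
      Subgroup.relIndex_top_right]
  -- assemble
  rw [← hN, ← hSF] at *
  rw [hE1]
  have : SF.index = (ιF.range ⊔ SE).index * Nh.range.index := by rw [← hker]; exact hE3
  rw [hE2]
  nlinarith [this, hE1]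

end Count

end Literature.NumberTheory.QuadraticForms
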